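import Summits.ResolutionOfSingularities.ResolutionOfSingularities.Theorems.RadicialJungCleanModelsGiraudLogJacobianStructure
import Summits.ResolutionOfSingularities.ResolutionOfSingularities.Theorems.RadicialJungCleanModelsGiraudTotalColength
import HarnessLib

/-!
# Route `RadicialJung`, crux `CleanModels` (stmt-15917): from "the critical primes are the
# height-one primes over the equation of `E`" to the explicit lists `{(x)}`, `{(x), (y)}`
# (adapters for `stub_lemma23`)

Support file (OURS) for PROGRAMME-clean-dim2 / T2 (`stub_lemma23`, hypotheses `hcritR` and
`hJT` of `RadicialJungCleanModelsGiraudStepPoint.lean`), line `via-clean-models` of the crux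
`DescentPerfectToAll` (stmt-0549). Nothing here is a statement of Hironaka's manuscript.

Geometry (bricks B2/B5-d) describes Giraud's critical primes of `f` at a point — the branches
of `E(f)` (Giraud 1983, 1.2–1.3: "`E(f) = (Spec 𝒪_X/J(X,f))_red`") — as **the height-one primes
of the local ring containing a local equation `g` of `E(f)`**: `g = x` or `g = x·y` at a point of
the strict normal crossings divisor `E(f)`, and, on a chart of the blow-up, `g = u′ᵃ·tᵇ` with
`u′` the exceptional equation and `t` the strict transform of a branch (a prime element or a
unit). This file turns that description into the explicit lists consumed by the algebra:

* `mem_derivCriticalPrimes_iff_of_generator_pow_mul_pow` — for `g = z₁ᵃ z₂ᵇ` (`a, b ≥ 1`) with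
  `z₁` prime and `z₂` prime or a unit: the critical primes are the `(zᵢ)` with `zᵢ` a non-unit
  (the shape `logDerivJacobianIdeal_eq_span_log₂` wants);
* `mem_derivCriticalPrimes_iff_of_generator_pow` — for `g = zᵃ` (`a ≥ 1`), `z` a non-unit
  prime: the only critical prime is `(z)`;
* `mem_derivCriticalPrimes_iff_of_rsop₁` / `…_of_rsop₂` — at a point of the snc divisor with
  regular parameters `(x, y)` and `I(E)_ξ = (x)` resp. `(xy)`: the lists `{(x)}` resp.
  `{(x), (y)}` (the shapes `hcritR` of `giraudColength_lt_of_nonCrossing_chart` /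
  `giraudColength_lt_of_crossing_chart`).

References: J. Giraud, Bull. SMF 111 (1983), 1.2–1.3 [Giraud1983].
-/

noncomputable section

set_option linter.dupNamespace false -- mandated namespace of this single-conjunct summit

open IsLocalRing Literature.AlgebraicGeometry.Resolution

namespace Summit.ResolutionOfSingularities.ResolutionOfSingularities.Theorems.RadicialJung.CleanModels

universe u

variable {O : Type u} [CommRing O] [IsDomain O] [IsNoetherianRing O]

/-- A height-one prime containing the prime element `z` is `(z)`. [folklore] -/
theorem eq_span_singleton_of_height_eq_one_of_mem {P : Ideal O} [P.IsPrime] (hP : P.height = 1)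
    {z : O} (hz : Prime z) (hzP : z ∈ P) : P = Ideal.span {z} := by
  haveI : (Ideal.span {z}).IsPrime := (Ideal.span_singleton_prime hz.ne_zero).mpr hz
  refine (Ideal.eq_of_le_of_height_le (Ideal.span {z}) (J := P)
    ((Ideal.span_singleton_le_iff_mem _).mpr hzP) ?_).symm
  rw [hP, height_span_singleton_eq_one_of_prime hz]

/-- **Critical primes from a local equation `g = z₁ᵃ z₂ᵇ` of `E`** (`a, b ≥ 1`, `z₁` prime, `z₂`
prime or a unit): they are exactly the `(zᵢ)` with `zᵢ` a non-unit.
[cite: Giraud1983, 1.2–1.3] -/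
theorem mem_derivCriticalPrimes_iff_of_generator_pow_mul_pow (f : O) {z₁ z₂ : O} {a b : ℕ}
    (ha : 1 ≤ a) (hb : 1 ≤ b) (hz₁ : Prime z₁) (hz₂ : Prime z₂ ∨ IsUnit z₂)
    (hcrit : ∀ P : Ideal O, P ∈ derivCriticalPrimes O f ↔
      (P.IsPrime ∧ P.height = 1 ∧ z₁ ^ a * z₂ ^ b ∈ P)) (P : Ideal O) :
    P ∈ derivCriticalPrimes O f ↔
      ((¬ IsUnit z₁ ∧ P = Ideal.span {z₁}) ∨ (¬ IsUnit z₂ ∧ P = Ideal.span {z₂})) := by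
  rw [hcrit]
  constructor
  · rintro ⟨hPp, hPh, hg⟩
    haveI := hPp
    rcases hPp.mem_or_mem hg with h1 | h2
    · exact Or.inl ⟨hz₁.not_unit,
        eq_span_singleton_of_height_eq_one_of_mem hPh hz₁ (hPp.mem_of_pow_mem a h1)⟩
    · have hz₂P : z₂ ∈ P := hPp.mem_of_pow_mem b h2
      have hnu : ¬ IsUnit z₂ := fun hu => hPp.ne_top (Ideal.eq_top_of_isUnit_mem _ hz₂P hu)
      exact Or.inr ⟨hnu, eq_span_singleton_of_height_eq_one_of_mem hPh (hz₂.resolve_right hnu) hz₂P⟩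
  · rintro (⟨-, rfl⟩ | ⟨hnu, rfl⟩)
    · refine ⟨(Ideal.span_singleton_prime hz₁.ne_zero).mpr hz₁,
        height_span_singleton_eq_one_of_prime hz₁, Ideal.mul_mem_right _ _ ?_⟩
      exact Ideal.pow_mem_of_mem _ (Ideal.mem_span_singleton_self z₁) a ha
    · have hz₂' : Prime z₂ := hz₂.resolve_right hnu
      refine ⟨(Ideal.span_singleton_prime hz₂'.ne_zero).mpr hz₂',
        height_span_singleton_eq_one_of_prime hz₂', Ideal.mul_mem_left _ _ ?_⟩
      exact Ideal.pow_mem_of_mem _ (Ideal.mem_span_singleton_self z₂) b hb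

/-- **Critical primes from a local equation `g = zᵃ` of `E`** (`a ≥ 1`, `z` a non-unit prime): the
only critical prime is `(z)`. [cite: Giraud1983, 1.2–1.3] -/
theorem mem_derivCriticalPrimes_iff_of_generator_pow (f : O) {z : O} {a : ℕ} (ha : 1 ≤ a)
    (hz : Prime z)
    (hcrit : ∀ P : Ideal O, P ∈ derivCriticalPrimes O f ↔ (P.IsPrime ∧ P.height = 1 ∧ z ^ a ∈ P))
    (P : Ideal O) : P ∈ derivCriticalPrimes O f ↔ P = Ideal.span {z} := by
  rw [hcrit]
  constructor
  · rintro ⟨hPp, hPh, hg⟩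
    haveI := hPp
    exact eq_span_singleton_of_height_eq_one_of_mem hPh hz (hPp.mem_of_pow_mem a hg)
  · rintro rfl
    exact ⟨(Ideal.span_singleton_prime hz.ne_zero).mpr hz, height_span_singleton_eq_one_of_prime hz,
      Ideal.pow_mem_of_mem _ (Ideal.mem_span_singleton_self z) a ha⟩

/-! ## At a point of the strict normal crossings divisor -/

section Rsop

variable {K : Type u} [Field K] {R : Subring K} [IsRegularLocalRing R] {x y : R}

/-- **Non-crossing point**: regular parameters `(x, y)`, local equation `x` of `E(f)`; the only
critical prime is `(x)`. [cite: Giraud1983, 1.2–1.3] -/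
theorem mem_derivCriticalPrimes_iff_of_rsop₁ (hdim : ringKrullDim R = 2)
    (hm : maximalIdeal R = Ideal.span {x, y}) (f : R)
    (hcrit : ∀ P : Ideal R, P ∈ derivCriticalPrimes R f ↔ (P.IsPrime ∧ P.height = 1 ∧ x ∈ P))
    (P : Ideal R) : P ∈ derivCriticalPrimes R f ↔ P = Ideal.span {x} := by
  have hx : Prime x := (prime_and_not_dvd_of_maximalIdeal_eq_span_pair hdim hm).1
  exact mem_derivCriticalPrimes_iff_of_generator_pow f (a := 1) le_rfl hx
    (fun P => by rw [hcrit P, pow_one]) P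

/-- **Crossing point**: regular parameters `(x, y)`, local equation `xy` of `E(f)`; the critical
primes are `(x)` and `(y)`. [cite: Giraud1983, 1.2–1.3] -/
theorem mem_derivCriticalPrimes_iff_of_rsop₂ (hdim : ringKrullDim R = 2)
    (hm : maximalIdeal R = Ideal.span {x, y}) (f : R)
    (hcrit : ∀ P : Ideal R, P ∈ derivCriticalPrimes R f ↔
      (P.IsPrime ∧ P.height = 1 ∧ x * y ∈ P))
    (P : Ideal R) : P ∈ derivCriticalPrimes R f ↔ (P = Ideal.span {x} ∨ P = Ideal.span {y}) := by
  have hm' : maximalIdeal R = Ideal.span {y, x} := by rw [hm, Set.pair_comm]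
  have hx : Prime x := (prime_and_not_dvd_of_maximalIdeal_eq_span_pair hdim hm).1
  have hy : Prime y := (prime_and_not_dvd_of_maximalIdeal_eq_span_pair hdim hm').1
  have h := mem_derivCriticalPrimes_iff_of_generator_pow_mul_pow f (a := 1) (b := 1) le_rfl le_rfl
    hx (Or.inl hy) (fun P => by rw [hcrit P, pow_one, pow_one]) P
  rw [h]
  constructor
  · rintro (⟨-, h⟩ | ⟨-, h⟩)
    · exact Or.inl h
    · exact Or.inr h
  · rintro (h | h)
    · exact Or.inl ⟨hx.not_unit, h⟩
    · exact Or.inr ⟨hy.not_unit, h⟩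

end Rsop

end Summit.ResolutionOfSingularities.ResolutionOfSingularities.Theorems.RadicialJung.CleanModels

end
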